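import Literature.AlgebraicGeometry.Resolution.DifferentialOperators
import Mathlib.RingTheory.Unramified.Field
import Mathlib.FieldTheory.PerfectClosure
import HarnessLib

/-!
# Differential operators over `R` are linear over every formally unramified `R`-algebra `L`

Topic: `Literature/AlgebraicGeometry/Resolution` (the tree's Grothendieck differential operators
`IsDiffOpLE`, file `DifferentialOperators.lean`). Let `R → L → A` be a tower of commutative rings and
`D : A → A` an `R`-linear differential operator of order `≤ n` in the sense of EGA IV₄ 16.8.8 (b)
(`IsDiffOpLE R n D`: all `(n+1)`-fold iterated commutators with multiplications vanish). If `L` is formally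
unramified over `R` (`Ω_{L/R} = 0`; e.g. `L` a separable algebraic field extension of a field `R`,
[Matsumura1987, Thm. 25.3]), then `D` commutes with the multiplications by elements of `L`, i.e. `D` is
`L`-linear (`IsDiffOpLE.commMul_algebraMap_eq_zero`, `IsDiffOpLE.map_algebraMap_mul`,
`IsDiffOpLE.map_smul_of_formallyUnramified`), and it is then a differential operator of the same order
relative to `L` (`IsDiffOpLE.exists_linearMap_over`, via the scalar-agnostic `IsDiffOpLE.of_coe_eq`). Proof: induction on the order; at order `n + 1` the map
`c ↦ [D, c]` is an `R`-derivation of `L` with values in the `L`-module `End_R(A)` — the Leibniz rule being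
exactly the induction hypothesis `[[D, c₁], c₂] = 0` — and derivations of a formally unramified algebra vanish
because they factor through `Ω_{L/R} = 0`. Field corollaries: `L/𝕂` separable algebraic
(`IsDiffOpLE.map_smul_of_isSeparable`), in particular `L` algebraic over a perfect `𝕂`
(`IsDiffOpLE.map_smul_of_perfectField`).

Motivation (cell `res-hironaka`, HIRONAKA-L lane; nothing about the manuscript is asserted here): in
Hironaka 2017 §7.4 p.39 l.31–40 the elementary differential operators of `O_η` over the perfect base field `𝕂`
are read inside `K(η)[[x − a]]`, `K(η)` separable algebraic over `𝕂`; their `K(η)`-linearity is this lemma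
(typed consumer: `Hironaka2017.S07Permissible.U39L37_perf`).

Sources: [EGAIV4] §16.8 (Déf. 16.8.1, Prop. 16.8.8) for the notion; [Matsumura1987] §25, Thm. 25.3
(separable algebraic ⇒ 0-étale ⇒ `Ω = 0`, derivations vanish) for the input.
-/

namespace Literature.AlgebraicGeometry.Resolution

section Tower

variable {R : Type*} {L : Type*} {A : Type*} [CommRing R] [CommRing L] [CommRing A]
  [Algebra R L] [Algebra L A] [Algebra R A] [IsScalarTower R L A]

/-- `[D, a₁ + a₂] = [D, a₁] + [D, a₂]`. [cite: EGAIV4, Prop. 16.8.8 (16.8.8.1)] -/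
private theorem commMul_right_add (D : A →ₗ[R] A) (a₁ a₂ : A) :
    commMul R D (a₁ + a₂) = commMul R D a₁ + commMul R D a₂ := by
  ext t; simp only [commMul_apply, LinearMap.add_apply, add_mul, map_add]; ring

/-- `[D, r • a] = r • [D, a]` for `r ∈ R` (`D` is `R`-linear). [cite: EGAIV4, Prop. 16.8.8 (16.8.8.1)] -/
private theorem commMul_right_smul (D : A →ₗ[R] A) (r : R) (a : A) :
    commMul R D (r • a) = r • commMul R D a := by
  ext t
  simp only [commMul_apply, LinearMap.smul_apply, smul_mul_assoc, map_smul, smul_sub]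

/-- `[D, 1] = 0`. [cite: EGAIV4, Prop. 16.8.8 (16.8.8.1)] -/
private theorem commMul_right_one (D : A →ₗ[R] A) : commMul R D (1 : A) = 0 := by
  ext t; simp only [commMul_apply, one_mul, LinearMap.zero_apply, sub_self]

/-- The iterated-commutator identity behind the Leibniz rule: if `[[D, a₁], a₂] = 0` then
`[D, a₁ a₂] = a₁ ∘ [D, a₂] + a₂ ∘ [D, a₁]` (pointwise). [cite: EGAIV4, Prop. 16.8.8 (b)] -/
theorem commMul_mul_right_of_commMul_commMul_eq_zero (D : A →ₗ[R] A) {a₁ a₂ : A}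
    (h : commMul R (commMul R D a₁) a₂ = 0) (t : A) :
    commMul R D (a₁ * a₂) t = a₁ * commMul R D a₂ t + a₂ * commMul R D a₁ t := by
  have ht := LinearMap.congr_fun h t
  simp only [commMul_apply, LinearMap.zero_apply] at ht
  simp only [commMul_apply]
  rw [mul_assoc]
  linear_combination ht

/-- **A differential operator over `R` commutes with every formally unramified `R`-algebra `L` acting on `A`**:
if `IsDiffOpLE R n D` and `Ω_{L/R} = 0`, then `[D, c] = 0` for every `c ∈ L` (as the multiplication by
`algebraMap L A c`). Induction on `n`: for order `≤ n + 1`, `c ↦ [D, c]` is an `R`-derivation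
`L → End_R(A)` (Leibniz = the induction hypothesis `[[D, c₁], c₂] = 0`), and `R`-derivations of `L` factor
through `Ω_{L/R} = 0`. [cite: Matsumura1987, Thm. 25.3; EGAIV4, Prop. 16.8.8 (b)] -/
theorem IsDiffOpLE.commMul_algebraMap_eq_zero [Algebra.FormallyUnramified R L] :
    ∀ {n : ℕ} {D : A →ₗ[R] A}, IsDiffOpLE R n D → ∀ c : L, commMul R D (algebraMap L A c) = 0
  | 0, D, hD => fun c => hD (algebraMap L A c)
  | n + 1, D, hD => by
    -- induction hypothesis for the commutators `[D, a]`, all of order `≤ n`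
    have ih : ∀ (a : A) (c : L), commMul R (commMul R D a) (algebraMap L A c) = 0 :=
      fun a c => IsDiffOpLE.commMul_algebraMap_eq_zero (hD a) c
    -- `c ↦ [D, c]` as an `R`-derivation of `L` into `End_R(A)` (an `L`-module through `A`)
    let δ : Derivation R L (A →ₗ[R] A) :=
      { toFun := fun c => commMul R D (algebraMap L A c)
        map_add' := fun c₁ c₂ => by rw [map_add, commMul_right_add]
        map_smul' := fun r c => by
          rw [RingHom.id_apply, Algebra.smul_def, map_mul, ← IsScalarTower.algebraMap_apply,
            ← Algebra.smul_def, commMul_right_smul]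
        map_one_eq_zero' := by
          change commMul R D (algebraMap L A 1) = 0
          rw [map_one, commMul_right_one]
        leibniz' := fun c₁ c₂ => by
          change commMul R D (algebraMap L A (c₁ * c₂)) =
            c₁ • commMul R D (algebraMap L A c₂) + c₂ • commMul R D (algebraMap L A c₁)
          ext t
          rw [map_mul, LinearMap.add_apply, LinearMap.smul_apply, LinearMap.smul_apply,
            Algebra.smul_def, Algebra.smul_def,
            commMul_mul_right_of_commMul_commMul_eq_zero (R := R) D (ih _ c₂) t] }
    intro c
    have hδ : δ c = commMul R D (algebraMap L A c) := rfl
    rw [← hδ, ← Derivation.liftKaehlerDifferential_comp_D δ c,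
      Subsingleton.elim (KaehlerDifferential.D R L c) 0, map_zero]

/-- `D (c · x) = c · D x` for `c ∈ L` (through `algebraMap L A`), `D` an `R`-differential operator of finite
order, `L/R` formally unramified. [cite: Matsumura1987, Thm. 25.3; EGAIV4, Prop. 16.8.8 (b)] -/
theorem IsDiffOpLE.map_algebraMap_mul [Algebra.FormallyUnramified R L] {n : ℕ} {D : A →ₗ[R] A}
    (hD : IsDiffOpLE R n D) (c : L) (x : A) :
    D (algebraMap L A c * x) = algebraMap L A c * D x := by
  have h := LinearMap.congr_fun (hD.commMul_algebraMap_eq_zero c) x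
  simp only [commMul_apply, LinearMap.zero_apply, sub_eq_zero] at h
  exact h

/-- `D (c • x) = c • D x` for `c ∈ L`, `D` an `R`-differential operator of finite order, `L/R` formally
unramified: `D` is `L`-linear. [cite: Matsumura1987, Thm. 25.3; EGAIV4, Prop. 16.8.8 (b)] -/
theorem IsDiffOpLE.map_smul_of_formallyUnramified [Algebra.FormallyUnramified R L] {n : ℕ}
    {D : A →ₗ[R] A} (hD : IsDiffOpLE R n D) (c : L) (x : A) : D (c • x) = c • D x := by
  rw [Algebra.smul_def, Algebra.smul_def, hD.map_algebraMap_mul]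

/-- Grothendieck's recursive criterion only involves commutators with elements of `A`: if an `R`-linear and an
`S`-linear endomorphism of `A` have the same underlying map, one is a differential operator of order `≤ n`
relative to `R` iff the other is relative to `S`. [cite: EGAIV4, Prop. 16.8.8 (b)] -/
theorem IsDiffOpLE.of_coe_eq {S : Type*} [CommRing S] [Algebra S A] :
    ∀ {n : ℕ} {D : A →ₗ[R] A} {D' : A →ₗ[S] A}, (⇑D' = ⇑D) → IsDiffOpLE R n D → IsDiffOpLE S n D'
  | 0, D, D', h, hD => fun a => by
    ext t
    have ht := LinearMap.congr_fun (hD a) t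
    simp only [commMul_apply, LinearMap.zero_apply] at ht ⊢
    simpa only [h] using ht
  | n + 1, D, D', h, hD => fun a =>
    IsDiffOpLE.of_coe_eq (n := n) (D := commMul R D a) (D' := commMul S D' a)
      (by ext t; simp only [commMul_apply, h]) (hD a)

/-- **An `R`-differential operator of order `≤ n` IS an `L`-differential operator of order `≤ n`** when `L/R` is
formally unramified: there is an `L`-linear endomorphism with the same underlying map, of order `≤ n` relative
to `L`. [cite: Matsumura1987, Thm. 25.3; EGAIV4, Prop. 16.8.8 (b)] -/
theorem IsDiffOpLE.exists_linearMap_over [Algebra.FormallyUnramified R L] {n : ℕ} {D : A →ₗ[R] A}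
    (hD : IsDiffOpLE R n D) : ∃ D' : A →ₗ[L] A, ⇑D' = ⇑D ∧ IsDiffOpLE L n D' := by
  let D' : A →ₗ[L] A :=
    { toFun := D
      map_add' := map_add D
      map_smul' := fun c x => hD.map_smul_of_formallyUnramified c x }
  exact ⟨D', rfl, IsDiffOpLE.of_coe_eq (D := D) rfl hD⟩

end Tower

/-! ## Field corollaries: separable algebraic extensions, perfect base fields -/

section Field

variable {𝕂 : Type*} {L : Type*} {A : Type*} [Field 𝕂] [Field L] [CommRing A]
  [Algebra 𝕂 L] [Algebra L A] [Algebra 𝕂 A] [IsScalarTower 𝕂 L A]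

/-- Over a separable algebraic field extension `L/𝕂`, every `𝕂`-differential operator of finite order on an
`L`-algebra `A` is `L`-linear (separable algebraic ⇒ 0-étale ⇒ `Ω_{L/𝕂} = 0`).
[cite: Matsumura1987, Thm. 25.3] -/
theorem IsDiffOpLE.map_smul_of_isSeparable [Algebra.IsSeparable 𝕂 L] {n : ℕ} {D : A →ₗ[𝕂] A}
    (hD : IsDiffOpLE 𝕂 n D) (c : L) (x : A) : D (c • x) = c • D x := by
  haveI : Algebra.FormallyUnramified 𝕂 L := Algebra.FormallyUnramified.of_isSeparable 𝕂 L
  exact hD.map_smul_of_formallyUnramified c x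

/-- Over a PERFECT field `𝕂`, every `𝕂`-differential operator of finite order on an algebra over an algebraic
extension `L` of `𝕂` is `L`-linear (algebraic over perfect ⇒ separable). [cite: Matsumura1987, Thm. 25.3 and
Thm. 26.3] -/
theorem IsDiffOpLE.map_smul_of_perfectField [PerfectField 𝕂] [Algebra.IsAlgebraic 𝕂 L] {n : ℕ}
    {D : A →ₗ[𝕂] A} (hD : IsDiffOpLE 𝕂 n D) (c : L) (x : A) : D (c • x) = c • D x := by
  haveI : Algebra.IsSeparable 𝕂 L := Algebra.IsAlgebraic.isSeparable_of_perfectField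
  exact hD.map_smul_of_isSeparable c x

end Field

end Literature.AlgebraicGeometry.Resolution
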